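import Mathlib
import Summits.Ventures.PercRepro2.V2SP
import Summits.Ventures.PercRepro2.HallOffFrame
import Summits.Ventures.PercRepro2.HallOffAxis
import Summits.Ventures.PercRepro2.Tail2DCount
import Summits.Ventures.PercRepro2.Tail2DThreePoint
import Summits.Ventures.PercRepro2.Tail2DP2Series
import Summits.Ventures.PercRepro2.Tail2DDisjointPaths
import Summits.Ventures.PercRepro2.Tail2DP2SeriesSP
import Summits.Ventures.PercRepro2.Tail2DAxisUnimodal
import Summits.Ventures.PercRepro2.Tail2DOffAxis31
import Summits.Ventures.PercRepro2.Tail2DRowOne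
import Summits.Ventures.PercRepro2.Tail2DStepRowZero
import Summits.Ventures.PercRepro2.Tail2DStepCert
import Summits.Ventures.PercRepro2.Tail2DStepFour
import Summits.Ventures.PercRepro2.Tail2DStepFiveCert
import Summits.Ventures.PercRepro2.Tail2DStepThreeFiveCert

/-!
# The STEP members `(1,5)`, `(2,5)`, `(3,5)` on every series–parallel network, and the anti-diagonal
member `T(5,3) ≤ T(4,4)` (seat mine-b, cell pub-perc-repro2; MINE-B.md §37.6)

The members of STEP with `j = 5` (`#{r = i ∧ b ≥ 5} ≤ #{r = i+1 ∧ b ≥ 4}`, `i = 1, 2, 3`), proved together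
by induction over the grammar exactly as in `Tail2DStepFour.lean`: the parallel steps are the linear-programming
certificates `step15_par`, `step25_par` (`Tail2DStepFiveCert.lean`) and `step35_par` (`Tail2DStepThreeFiveCert.lean`); the series steps use `step_ser` with
the anti-diagonal comparisons at level `5` obtained by telescoping (`tail_le_of_steps`) from the same members.
The lower members are the theorems of `Tail2DStepRowZero.lean` (row `0`), `step_one_three`, `step_four`.

COROLLARIES: `t53_le_t44`, `T(5,3) ≤ T(4,4)`, and `t52_le_t43`, `T(5,2) ≤ T(4,3)` — the members `(5,3)` and `(5,2)`
of the off-axis family, beyond the reach of certificates over the off-axis hypotheses (registry §36.1, §36.5).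
-/

namespace Summit.Ventures.PercRepro2.Tail2D

open V2Closure


/-- **STEP(1,5), STEP(2,5) and STEP(3,5) on every pattern of the grammar** -/
theorem step_five : ∀ s : V2Closure.SP,
    ((Finset.univ.filter (fun y : s.Conf => s.rLab y = 1 ∧ 5 ≤ s.bLab y)).card
      ≤ (Finset.univ.filter (fun y : s.Conf => s.rLab y = 1 + 1 ∧ 5 - 1 ≤ s.bLab y)).card)
    ∧ ((Finset.univ.filter (fun y : s.Conf => s.rLab y = 2 ∧ 5 ≤ s.bLab y)).card
      ≤ (Finset.univ.filter (fun y : s.Conf => s.rLab y = 2 + 1 ∧ 5 - 1 ≤ s.bLab y)).card)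
    ∧ ((Finset.univ.filter (fun y : s.Conf => s.rLab y = 3 ∧ 5 ≤ s.bLab y)).card
      ≤ (Finset.univ.filter (fun y : s.Conf => s.rLab y = 3 + 1 ∧ 5 - 1 ≤ s.bLab y)).card)
  | .free => ⟨step_atom .free (Or.inl rfl) 1 5 (by norm_num), step_atom .free (Or.inl rfl) 2 5 (by norm_num),
      step_atom .free (Or.inl rfl) 3 5 (by norm_num)⟩
  | .pin => ⟨step_atom .pin (Or.inr (Or.inl rfl)) 1 5 (by norm_num), step_atom .pin (Or.inr (Or.inl rfl)) 2 5 (by norm_num),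
      step_atom .pin (Or.inr (Or.inl rfl)) 3 5 (by norm_num)⟩
  | .absent => ⟨step_atom .absent (Or.inr (Or.inr rfl)) 1 5 (by norm_num), step_atom .absent (Or.inr (Or.inr rfl)) 2 5 (by norm_num),
      step_atom .absent (Or.inr (Or.inr rfl)) 3 5 (by norm_num)⟩
  | .ser s t => by
    have ihs := step_five s
    have iht := step_five t
    have hT15t : (Finset.univ.filter (fun y : t.Conf => 1 ≤ t.rLab y ∧ 5 ≤ t.bLab y)).card
        ≤ (Finset.univ.filter (fun y : t.Conf => 1 + 1 ≤ t.rLab y ∧ 5 - 1 ≤ t.bLab y)).card :=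
      tail_le_of_steps t 5 2 1 rfl (fun k hk hkj => by
        rcases (by omega : k = 1 ∨ k = 2 ∨ k = 3) with h | h | h
        · subst h; exact iht.1
        · subst h; exact iht.2.1
        · subst h; exact iht.2.2)
    have hT25s : (Finset.univ.filter (fun y : s.Conf => 1 + 1 ≤ s.rLab y ∧ 5 ≤ s.bLab y)).card
        ≤ (Finset.univ.filter (fun y : s.Conf => 1 + 1 + 1 ≤ s.rLab y ∧ 5 - 1 ≤ s.bLab y)).card :=
      tail_le_of_steps s 5 1 2 rfl (fun k hk hkj => by
        rcases (by omega : k = 2 ∨ k = 3) with h | h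
        · subst h; exact ihs.2.1
        · subst h; exact ihs.2.2)
    have hT25t : (Finset.univ.filter (fun y : t.Conf => 2 ≤ t.rLab y ∧ 5 ≤ t.bLab y)).card
        ≤ (Finset.univ.filter (fun y : t.Conf => 2 + 1 ≤ t.rLab y ∧ 5 - 1 ≤ t.bLab y)).card :=
      tail_le_of_steps t 5 1 2 rfl (fun k hk hkj => by
        rcases (by omega : k = 2 ∨ k = 3) with h | h
        · subst h; exact iht.2.1
        · subst h; exact iht.2.2)
    have hT35s : (Finset.univ.filter (fun y : s.Conf => 2 + 1 ≤ s.rLab y ∧ 5 ≤ s.bLab y)).card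
        ≤ (Finset.univ.filter (fun y : s.Conf => 2 + 1 + 1 ≤ s.rLab y ∧ 5 - 1 ≤ s.bLab y)).card :=
      tail_le_of_steps s 5 0 3 rfl (fun k hk hkj => by
        have h : k = 3 := by omega
        subst h; exact ihs.2.2)
    have hT35t : (Finset.univ.filter (fun y : t.Conf => 3 ≤ t.rLab y ∧ 5 ≤ t.bLab y)).card
        ≤ (Finset.univ.filter (fun y : t.Conf => 3 + 1 ≤ t.rLab y ∧ 5 - 1 ≤ t.bLab y)).card :=
      tail_le_of_steps t 5 0 3 rfl (fun k hk hkj => by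
        have h : k = 3 := by omega
        subst h; exact iht.2.2)
    have hT45s : (Finset.univ.filter (fun y : s.Conf => 3 + 1 ≤ s.rLab y ∧ 5 ≤ s.bLab y)).card
        ≤ (Finset.univ.filter (fun y : s.Conf => 3 + 1 + 1 ≤ s.rLab y ∧ 5 - 1 ≤ s.bLab y)).card := by
      exact le_of_eq (by rw [tail_symm s (3 + 1 + 1) (5 - 1)])
    exact ⟨step_ser s t 1 5 ihs.1 iht.1 hT15t hT25s, step_ser s t 2 5 ihs.2.1 iht.2.1 hT25t hT35s,
      step_ser s t 3 5 ihs.2.2 iht.2.2 hT35t hT45s⟩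
  | .par s t => by
    have ihs := step_five s
    have iht := step_five t
    have s02 := SP.sum_psi_zero_nonneg s 2 (by norm_num)
    have s03 := SP.sum_psi_zero_nonneg s 3 (by norm_num)
    have s04 := SP.sum_psi_zero_nonneg s 4 (by norm_num)
    have s05 := SP.sum_psi_zero_nonneg s 5 (by norm_num)
    have t02 := SP.sum_psi_zero_nonneg t 2 (by norm_num)
    have t03 := SP.sum_psi_zero_nonneg t 3 (by norm_num)
    have t04 := SP.sum_psi_zero_nonneg t 4 (by norm_num)
    have t05 := SP.sum_psi_zero_nonneg t 5 (by norm_num)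
    have s13 : 0 ≤ ∑ x, psi 1 3 (s.rLab x) (s.bLab x) := (step_iff' s 1 3).1 (step_one_three s)
    have t13 : 0 ≤ ∑ x, psi 1 3 (t.rLab x) (t.bLab x) := (step_iff' t 1 3).1 (step_one_three t)
    have s12 : 0 ≤ ∑ x, psi 1 2 (s.rLab x) (s.bLab x) := by rw [sum_psi_offset_one]; exact s13
    have t12 : 0 ≤ ∑ x, psi 1 2 (t.rLab x) (t.bLab x) := by rw [sum_psi_offset_one]; exact t13
    have s14 : 0 ≤ ∑ x, psi 1 4 (s.rLab x) (s.bLab x) := (step_iff' s 1 4).1 (step_four s).1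
    have t14 : 0 ≤ ∑ x, psi 1 4 (t.rLab x) (t.bLab x) := (step_iff' t 1 4).1 (step_four t).1
    have s24 : 0 ≤ ∑ x, psi 2 4 (s.rLab x) (s.bLab x) := (step_iff' s 2 4).1 (step_four s).2
    have t24 : 0 ≤ ∑ x, psi 2 4 (t.rLab x) (t.bLab x) := (step_iff' t 2 4).1 (step_four t).2
    have s23 : 0 ≤ ∑ x, psi 2 3 (s.rLab x) (s.bLab x) := by rw [sum_psi_offset_one]; exact s24
    have t23 : 0 ≤ ∑ x, psi 2 3 (t.rLab x) (t.bLab x) := by rw [sum_psi_offset_one]; exact t24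
    have s15 : 0 ≤ ∑ x, psi 1 5 (s.rLab x) (s.bLab x) := (step_iff' s 1 5).1 ihs.1
    have t15 : 0 ≤ ∑ x, psi 1 5 (t.rLab x) (t.bLab x) := (step_iff' t 1 5).1 iht.1
    have s25 : 0 ≤ ∑ x, psi 2 5 (s.rLab x) (s.bLab x) := (step_iff' s 2 5).1 ihs.2.1
    have t25 : 0 ≤ ∑ x, psi 2 5 (t.rLab x) (t.bLab x) := (step_iff' t 2 5).1 iht.2.1
    have s35 : 0 ≤ ∑ x, psi 3 5 (s.rLab x) (s.bLab x) := (step_iff' s 3 5).1 ihs.2.2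
    have t35 : 0 ≤ ∑ x, psi 3 5 (t.rLab x) (t.bLab x) := (step_iff' t 3 5).1 iht.2.2
    have s34 : 0 ≤ ∑ x, psi 3 4 (s.rLab x) (s.bLab x) := by rw [sum_psi_offset_one]; exact s35
    have t34 : 0 ≤ ∑ x, psi 3 4 (t.rLab x) (t.bLab x) := by rw [sum_psi_offset_one]; exact t35
    have sa3 := SP.hallFn_phi_axis_count s 3 (by norm_num)
    have ta3 := SP.hallFn_phi_axis_count t 3 (by norm_num)
    have sa4 := SP.hallFn_phi_axis_count s 4 (by norm_num)
    have ta4 := SP.hallFn_phi_axis_count t 4 (by norm_num)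
    have sa5 := SP.hallFn_phi_axis_count s 5 (by norm_num)
    have ta5 := SP.hallFn_phi_axis_count t 5 (by norm_num)
    have sr4 := SP.sum_phi_row_nonneg s 4 (by norm_num)
    have tr4 := SP.sum_phi_row_nonneg t 4 (by norm_num)
    have sr5 := SP.sum_phi_row_nonneg s 5 (by norm_num)
    have tr5 := SP.sum_phi_row_nonneg t 5 (by norm_num)
    exact ⟨(step_iff' (.par s t) 1 5).2 (step15_par s t sa3 s04 s05 s13 s14 s15 t03 t04 t05 t12 t13 t14 t15),
      (step_iff' (.par s t) 2 5).2 (step25_par s t sa4 sr4 s03 s04 s05 s12 s14 s15 s23 s24 s25 ta4 t03 t04 t05 t13 t14 t15 t23 t24 t25),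
      (step_iff' (.par s t) 3 5).2 (step35_par s t sa5 sr5 s02 s03 s04 s05 s13 s14 s15 s24 s25 s34 s35 ta5 tr5 t02 t03 t04 t05 t13 t14 t15 t24 t25 t34 t35)⟩

/-- **five edge-disjoint red paths together with three edge-disjoint blue paths are rarer than four and
four**, on every pattern of the grammar: `T(5,3) ≤ T(4,4)`, the member `(5,3)` of the off-axis family. -/
theorem t53_le_t44 (s : V2Closure.SP) :
    (Finset.univ.filter (fun y : s.Conf => 5 ≤ s.rLab y ∧ 3 ≤ s.bLab y)).card
      ≤ (Finset.univ.filter (fun y : s.Conf => 4 ≤ s.rLab y ∧ 4 ≤ s.bLab y)).card :=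
  (step_diag_iff s 3).1 (step_five s).2.2

/-- the same in the vocabulary of `Tail2DP2Series` -/
theorem stat_t53_le_t44 (s : V2Closure.SP) :
    stat s (fun r b => 5 ≤ r ∧ 3 ≤ b) ≤ stat s (fun r b => 4 ≤ r ∧ 4 ≤ b) :=
  t53_le_t44 s

/-- **five edge-disjoint red paths together with two edge-disjoint blue paths are rarer than four and
three**: `T(5,2) ≤ T(4,3)`, the member `(5,2)` of the off-axis family — the telescoping of `STEP(2,5)`,
`STEP(3,5)` gives `T(2,5) ≤ T(3,4)`, and the colour swap finishes. -/
theorem t52_le_t43 (s : V2Closure.SP) :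
    (Finset.univ.filter (fun y : s.Conf => 5 ≤ s.rLab y ∧ 2 ≤ s.bLab y)).card
      ≤ (Finset.univ.filter (fun y : s.Conf => 4 ≤ s.rLab y ∧ 3 ≤ s.bLab y)).card := by
  have h := tail_le_of_steps s 5 1 2 rfl (fun k hk hkj => by
    rcases (by omega : k = 2 ∨ k = 3) with h | h
    · subst h; exact (step_five s).2.1
    · subst h; exact (step_five s).2.2)
  rw [tail_symm s 5 2, tail_symm s 4 3]
  exact h

/-- the same in the vocabulary of `Tail2DP2Series` -/
theorem stat_t52_le_t43 (s : V2Closure.SP) :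
    stat s (fun r b => 5 ≤ r ∧ 2 ≤ b) ≤ stat s (fun r b => 4 ≤ r ∧ 3 ≤ b) :=
  t52_le_t43 s

end Summit.Ventures.PercRepro2.Tail2D
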